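import Summits.HodgeConjecture.HodgeConjecture.Theorems.F0P6aSiegelCarrierReciprocity
import Literature.AlgebraicGeometry.ShimuraVarieties.UnitaryCurveSpecialPairReciprocityMover
import HarnessLib

/-!
# The CM reciprocity DATUM of the E-line chart at its special points, over the slice field — together with `f_recip` from ONE `E₀`

Summit `HodgeConjecture`, sub-problem `HodgeConjecture`, crux `stmt-HodgeConjecture-24832` (HLiu418), sub-line P6a, E-line
`Cruxes/HLiu418/Lines/F0_P6a_PELWitnessE.lean` (ED. 4 → ED. 5), line L6 = the Σ-GAL half of `stub_E6` (organ (K-a), LA6-p01 (g0)).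
Cell `hodgecm-mathlib` (D-0151); HONEST LABEL: HC_CM is proved only modulo the 2 remaining named inputs (hLiu418 24832, h413 24833) until rung 0
closes; this file is a `--supports 24832` helper and changes no count.  THEOREMS ONLY; imports ★ Theorems ∕ ★ Literature only.

WHY (typed finding, squad bus F0∕P6 02:02Z).  The Σ-GAL socket (`ReadsCReading → ReadsCGalois`) needs, at every special complex point `[ι₁w, a]` of
the record curve, the INPUT BLOCK `(c, J, Φ′, E, σ, s♯, r)` of ★ `MumfordRouteXi.cmConjugationIsogenyAll_holds` (special pair, reflex fields inside a
number field `E` FIXED by `σ`, Artin correspondent over `E`, reciprocity element) — but the chart `C : AuxChartGS` of `stub_E6`'s binders is ABSTRACT: its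
Hodge-embedding datum `C.J` carries no CM structure and the slice-field cover `E₀ ⊆ τE(Fᵢ)` that paid `C.f_recip` (★ `F0P6aSpecialPairRecipOfChart`)
is forgotten by the structure.  The cure is an ED. 5 field carrying that block BY VALUE at `J(ι₁ w)`; this file makes it PAYABLE AT BIRTH by the
`stub_E123` body with ONE call, from the SAME `E₀` as `f_recip` (so the Galois envelope `Fᵢ₀ ⊇ E₀` GEN already takes serves both fields):
* §1 `smul_f_mk_eq_of_cmDatum` — E3R-S GLUE, chart-generic: for ANY Hodge-embedding datum `J`, ANY group map `b` and ANY point map `f` with the shadow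
  formula `pts (f [v, aK]) = [J v, b a]`, the CM datum at `(σ, w, d, a)` — `(c, J(ι₁w))` special of types `Φ′`, `E*(Φ′ᵢ) ⊆ E`, `σ|_E = id`, `s♯` an Artin
  correspondent of `σ` over `E`, `r` of matrix `c.cmRecipMatrix Φ′ E s♯`, `[J(ι₁w), r·b(a)] = [J(ι₁w), b(d♯a)]`, `[ι₁w, d·a]_K = [ι₁w, d♯·a]_K` — gives the
  `f_recip` equation `σ • f [ι₁w, a] = f [ι₁w, d·a]` (★ E3R-S `smul_q_mk_eq_q_mk_cmRecip_of_forall_mem_apply_eq` read through `f`).  So `f_recip` is a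
  COROLLARY of the datum for every chart.
* §2 `exists_sliceField_f_recip_cmDatum` — for the concrete chart data of `stub_E123` (★ E3 A4 clauses, (U3-D3), E1's frame `Fr`, E2's
  `J = auxComplexStructureV Fr ι₁ Φ`, `b = ũ_V(·,1)`): ONE number field `E₀ ∋ ι₁(F)` such that over every slice field `Fᵢ` covering `E₀` BOTH hold — the
  `f_recip` clause VERBATIM (ED. 4 :291) AND the CM datum clause for every `σ : ℂ ≃ₐ[Fᵢ] ℂ` (read in `Aut(ℂ∕ℚ)` by `restrictScalars`).  Proof: `E₀` :=
  ★ E3R-U's (`UnitaryCurve.AuxV.exists_sliceField_siegelRecipDatum_curve`, LA6-p01 p847714); the datum is its output, `f_recip` is §1 of it.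
The Σ-GAL skeleton then moves the datum to the kernel's `J(Z a v) = (q a)_ℝ⁻¹ J(v) (q a)_ℝ` by ★ `CMStructure.IsSpecial.exists_inv_conj_recip_of_conjJ_eq`
(LA6-p01 p847688) along `C.q_spec`.
[cite: Milne2005ShimuraVarieties, Def. 12.8 (62) p. 114, Prop. 14.12 p. 125] [cite: Deligne1971TravauxShimura, 5.11 p. 158, Thm. 4.21 p. 152]
[cite: RapoportSmithlingZhang2020Diagonal, Remark 3.1 p. 9, (3.3), (3.10)]
-/

set_option autoImplicit false

noncomputable section

-- the mandated namespace has the single-problem summit's repeated segment (`HodgeConjecture.HodgeConjecture`)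
set_option linter.dupNamespace false

namespace Summit.HodgeConjecture.HodgeConjecture.Theorems.F0P6aSpecialPairRecipDatumOfChart

open CategoryTheory AlgebraicGeometry Matrix NumberField IsDedekindDomain
open Literature.AlgebraicGeometry.ModuliOfAbelianVarieties
open Literature.AlgebraicGeometry.ModuliOfAbelianVarieties.SiegelModuli (jOfSiegel jOfSiegel_mem_C0)
open Literature.AlgebraicGeometry.Motives (SchemeOver ComplexPoints AlgPoints specOver CMType)
open Literature.AlgebraicGeometry.AbelianSchemes (PolarizedAbelianSchemeWithLevel)
open Literature.NumberTheory.Automorphic Literature.NumberTheory.Automorphic.UnitaryGroup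
open Literature.NumberTheory.ComplexMultiplication (traceField)
open Literature.AlgebraicGeometry.ShimuraVarieties
open Literature.AlgebraicGeometry.ShimuraVarieties.UnitaryCanonicalModel (IsArtinCorrespondent recipFactor IsDiagTwistGS ShimuraSetGS)
open Literature.AlgebraicGeometry.ShimuraVarieties.UnitaryCurve.AuxV
open Summit.HodgeConjecture.HodgeConjecture.Theorems.F0P6aSiegelCarrierReciprocity (smul_q_mk_eq_q_mk_cmRecip_of_forall_mem_apply_eq)

/-! ### §1 E3R-S glue, chart-generic: the CM datum at `(σ, w, d, a)` gives the `f_recip` equation -/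

/-- **`f_recip` IS A COROLLARY OF THE CM DATUM, FOR ANY CHART** (E3R-S glue, chart-generic): Siegel carrier data `(𝓜, Sc, ιc, unif, u, rep, pts)` with
A4's clauses and (U3-D3) as in ★ `smul_q_mk_eq_q_mk_cmRecip_of_forall_mem_apply_eq`; a curve datum `(F, ι₁, J⋆)`; ANY Hodge-embedding datum `J` with
`hJC : J v ∈ S^±`, ANY map `b : U(J⋆)(𝔸_f) → GSp_δ(𝔸_f)` and ANY point map `f` at level `K` with the shadow formula `pts (f [v, aK]) = [J v, b a]_{K_δ(N)}`
(`AuxChartGS.f_pts`).  If at `(σ, w, d, a)` the CM DATUM holds — `(c, J(ι₁w))` special of types `Φ′`, `E*(Φ′ᵢ) ⊆ E`, `σ` fixes `E`, `s♯` is an Artin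
correspondent of `σ` over `E ⊂ ℂ`, `r ∈ GSp_δ(𝔸_f)` has matrix `c.cmRecipMatrix Φ′ E s♯`, `[J(ι₁w), r·b(a)] = [J(ι₁w), b(d♯·a)]` in `Sh_{K_δ(N)}` and
`[ι₁w, d·a]_K = [ι₁w, d♯·a]_K` — then `σ • f [ι₁w, aK] = f [ι₁w, d·aK]`.  Proof = ★ E3R-S at `(c, J(ι₁w), Φ′, E, σ, s♯, r, b a)` read through `f` by the
shadow formula (the last block of ★ `exists_sliceField_f_recip`, abstracted from `auxComplexStructureV`∕`ũ_V`).
[cite: Milne2005ShimuraVarieties, Def. 12.8 (62) p. 114 and Prop. 14.12 p. 125] [cite: Deligne1971TravauxShimura, Thm. 4.21 p. 152] -/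
theorem smul_f_mk_eq_of_cmDatum {g N : ℕ} {δ : Fin g → ℕ} (hg : 0 < g) (hδ : IsPolarizationType δ) (hN : 3 ≤ N)
    (𝓜 : SiegelFineModuliScheme g N δ)
    {Sc : (ZMod N)ˣ → SchemeOver ℂ} (ιc : ∀ c, Sc c ⟶ (Literature.AlgebraicGeometry.Motives.baseChange ℚ ℂ).obj 𝓜.M)
    (unif : ∀ _c : (ZMod N)ˣ, Matrix (Fin g) (Fin g) ℂ → ComplexPoints (Sc _c))
    {u : (ZMod N)ˣ → finAdeleQˣ} {rep : (ZMod N)ˣ → ↥(gspFinAdelic δ)}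
    (hu : ∀ c w, Valued.v ((u c : finAdeleQ) w) = 1)
    (huc : ∀ c, (u c : finAdeleQ) - ((c : ZMod N).val : ℕ) ∈ levelIdeal N)
    (hmult : ∀ c, IsMultiplier (typeFormOver δ finAdeleQ) (rep c : GL (Fin g ⊕ Fin g) finAdeleQ) (u c))
    (hD3 : haveI : IsLocallyNoetherian (specOver ℚ ℂ).left := inferInstanceAs (IsLocallyNoetherian (Spec (CommRingCat.of ℂ)))
      ∀ (c : (ZMod N)ˣ) (Z : Matrix (Fin g) (Fin g) ℂ) (hZ : Z ∈ siegelUpperHalfSpace g)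
        (P' : PolarizedAbelianSchemeWithLevel g N δ (specOver ℚ ℂ).left), IsAdmissibleAt hδ (rep c) Z hZ P' →
          AlgPoints.map (ιc c) (unif c Z) =
            AlgPoints.baseChangeEquiv (algebraMap ℚ ℂ) 𝓜.M (𝓜.classifyingMap (specOver ℚ ℂ) P'))
    (pts : ComplexPoints ((Literature.AlgebraicGeometry.Motives.baseChange ℚ ℂ).obj 𝓜.M) ≃
      SiegelShimuraSet δ (principalLevelSubgroup δ N))
    (hval : ∀ (c : (ZMod N)ˣ) (W : Matrix (Fin g) (Fin g) ℂ) (hW : W ∈ siegelUpperHalfSpace g),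
      pts (AlgPoints.map (ιc c) (unif c W)) =
        SiegelShimuraSet.mk δ (principalLevelSubgroup δ N)
          ⟨jOfSiegel δ W, C0_subset_C0pm δ (jOfSiegel_mem_C0 hδ.1 hW)⟩ (rep c))
    -- the curve datum, ANY Hodge-embedding datum, ANY group map, ANY point map with the shadow formula
    {F : Type} [Field F] [NumberField F] [IsCMField F] (ι₁ : F →+* ℂ) (Jstar : Matrix (Fin 2) (Fin 2) F)
    (J : (Fin 2 → ℂ) → Matrix (Fin g ⊕ Fin g) (Fin g ⊕ Fin g) ℝ)
    (hJC : ∀ v : Fin 2 → ℂ, v ∈ negCone (Jstar.map ι₁) → J v ∈ C0pm δ)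
    (K : Subgroup ↥(finAdelic (↥(maximalRealSubfield F)) F (IsCMField.complexConj F) 2 Jstar))
    (b : ↥(finAdelic (↥(maximalRealSubfield F)) F (IsCMField.complexConj F) 2 Jstar) → ↥(gspFinAdelic δ))
    (f : ShimuraSetGS F Jstar ι₁ K → ComplexPoints 𝓜.M)
    (hf : ∀ (v : Fin 2 → ℂ) (hv : v ∈ negCone (Jstar.map ι₁)) (a : ↥(finAdelic (↥(maximalRealSubfield F)) F (IsCMField.complexConj F) 2 Jstar)),
      pts (AlgPoints.baseChangeEquiv (algebraMap ℚ ℂ) 𝓜.M (f (ShimuraSetGS.mk F Jstar ι₁ K v hv a))) =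
        SiegelShimuraSet.mk δ (principalLevelSubgroup δ N) ⟨J v, hJC v hv⟩ (b a))
    -- the point `(σ, w, d, a)` and the CM datum there
    (σ : ℂ ≃ₐ[ℚ] ℂ) (w : Fin 2 → F) (hw : (fun i => ι₁ (w i)) ∈ negCone (Jstar.map ι₁))
    (d a : ↥(finAdelic (↥(maximalRealSubfield F)) F (IsCMField.complexConj F) 2 Jstar))
    (E : IntermediateField ℚ ℂ) [NumberField ↥E] (c : CMStructure g δ (Fin 2) (fun _ => F)) (Φ' : Fin 2 → CMType F)
    (sE : (FiniteAdeleRing (𝓞 ↥E) ↥E)ˣ) (r : ↥(gspFinAdelic δ)) (d' : ↥(finAdelic (↥(maximalRealSubfield F)) F (IsCMField.complexConj F) 2 Jstar))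
    (hsp : c.IsSpecial ⟨J (fun i => ι₁ (w i)), hJC _ hw⟩ Φ') (hE : ∀ i, traceField (Φ' i) ≤ E) (hσ : ∀ x : ℂ, x ∈ E → σ x = x)
    (hsE : IsArtinCorrespondent ↥E (algebraMap ↥E ℂ) sE σ.toRingEquiv)
    (hr : ((r : GL (Fin g ⊕ Fin g) finAdeleQ) : Matrix (Fin g ⊕ Fin g) (Fin g ⊕ Fin g) finAdeleQ) = c.cmRecipMatrix Φ' E sE)
    (hS : SiegelShimuraSet.mk δ (principalLevelSubgroup δ N) ⟨J (fun i => ι₁ (w i)), hJC _ hw⟩ (r * b a) =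
      SiegelShimuraSet.mk δ (principalLevelSubgroup δ N) ⟨J (fun i => ι₁ (w i)), hJC _ hw⟩ (b (d' * a)))
    (hK : ShimuraSetGS.mk F Jstar ι₁ K (fun i => ι₁ (w i)) hw (d * a) = ShimuraSetGS.mk F Jstar ι₁ K (fun i => ι₁ (w i)) hw (d' * a)) :
    σ • f (ShimuraSetGS.mk F Jstar ι₁ K (fun i => ι₁ (w i)) hw a) = f (ShimuraSetGS.mk F Jstar ι₁ K (fun i => ι₁ (w i)) hw (d * a)) := by
  classical
  -- E3R-S at the special pair `(c, J(ι₁ w), Φ′)` and the class `[J(ι₁w), b a]`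
  have hSrec := smul_q_mk_eq_q_mk_cmRecip_of_forall_mem_apply_eq hg hδ hN 𝓜 ιc unif hu huc hmult hD3 pts hval (Fin 2) (fun _ => F) c
    ⟨J (fun i => ι₁ (w i)), hJC _ hw⟩ Φ' hsp E hE σ hσ sE hsE r hr (b a)
  -- read both sides through `f` by the shadow formula
  have hread : ∀ a' : ↥(finAdelic (↥(maximalRealSubfield F)) F (IsCMField.complexConj F) 2 Jstar),
      f (ShimuraSetGS.mk F Jstar ι₁ K (fun i => ι₁ (w i)) hw a') =
        (AlgPoints.baseChangeEquiv (algebraMap ℚ ℂ) 𝓜.M).symm (pts.symm (SiegelShimuraSet.mk δ (principalLevelSubgroup δ N)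
          ⟨J (fun i => ι₁ (w i)), hJC _ hw⟩ (b a'))) := by
    intro a'
    have h1 : (AlgPoints.baseChangeEquiv (algebraMap ℚ ℂ) 𝓜.M) (f (ShimuraSetGS.mk F Jstar ι₁ K (fun i => ι₁ (w i)) hw a')) =
        pts.symm (SiegelShimuraSet.mk δ (principalLevelSubgroup δ N) ⟨J (fun i => ι₁ (w i)), hJC _ hw⟩ (b a')) :=
      (Equiv.eq_symm_apply pts).2 (hf _ hw a')
    exact (Equiv.eq_symm_apply (AlgPoints.baseChangeEquiv (algebraMap ℚ ℂ) 𝓜.M)).2 h1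
  rw [hK, hread a, hSrec, hS, ← hread (d' * a)]

/-! ### §2 The concrete chart of `stub_E123`: ONE `E₀` for `f_recip` AND the CM datum -/

/-- **`f_recip` AND THE CM RECIPROCITY DATUM OF THE E-LINE CHART, FROM ONE SLICE FIELD** (ED. 5 at-birth constructor; the binders of ★
`F0P6aSpecialPairRecipOfChart.exists_sliceField_f_recip` VERBATIM): for the Siegel data of `stub_E123` (★ E3 A4 clauses + (U3-D3)), the curve datum,
E1's frame `Fr`, E2's `J = auxComplexStructureV Fr ι₁ Φ` and any point map `f` with `pts (f [v, aK]) = [J v, ũ_V(a,1)]`, there is a number field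
`E₀ ∋ ι₁(F)` such that for EVERY slice field `Fᵢ` (`τE`) covering `E₀` BOTH hold: (i) `f_recip` — `∀ σ ∈ Aut(ℂ∕Fᵢ), ∀ s` (Artin correspondent over `F`),
`∀ w` special, `∀ d` twist by `r_w(s)`, `∀ a`, `σ • f [ι₁w, aK] = f [ι₁w, d·aK]`; (ii) THE CM DATUM — for the same `(σ, s, w, d, a)` there are `(E, c, Φ′, s♯, r, d♯)`:
`(c, J(ι₁w))` a CM special pair of types `Φ′`, `E*(Φ′ᵢ) ⊆ E`, `σ` fixes `E` pointwise, `s♯` an Artin correspondent of `σ|_ℚ` over `E ⊂ ℂ`, `r ∈ GSp_δ(𝔸_f)` of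
matrix `c.cmRecipMatrix Φ′ E s♯` (= the `hsp hE σ s hs r hr` block of ★ `cmConjugationIsogenyAll_holds`), and the class identities `[J(ι₁w), r·ũ_V(a,1)]_{K_δ(N)}
= [J(ι₁w), ũ_V(d♯a,1)]_{K_δ(N)}`, `[ι₁w, d·a]_{K′} = [ι₁w, d♯·a]_{K′}` at every level `K′`.  (ii) = ★ E3R-U `exists_sliceField_siegelRecipDatum_curve`; (i) = §1 of (ii).
[cite: Milne2005ShimuraVarieties, Def. 12.8 (62) p. 114 and Prop. 14.12 p. 125] [cite: Deligne1971TravauxShimura, 5.11 p. 158 and Thm. 4.21 p. 152]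
[cite: RapoportSmithlingZhang2020Diagonal, Remark 3.1 p. 9 and (3.10)] -/
theorem exists_sliceField_f_recip_cmDatum {g N : ℕ} {δ : Fin g → ℕ} (hg : 0 < g) (hδ : IsPolarizationType δ) (hN : 3 ≤ N)
    (𝓜 : SiegelFineModuliScheme g N δ)
    {Sc : (ZMod N)ˣ → SchemeOver ℂ} (ιc : ∀ c, Sc c ⟶ (Literature.AlgebraicGeometry.Motives.baseChange ℚ ℂ).obj 𝓜.M)
    (unif : ∀ _c : (ZMod N)ˣ, Matrix (Fin g) (Fin g) ℂ → ComplexPoints (Sc _c))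
    {u : (ZMod N)ˣ → finAdeleQˣ} {rep : (ZMod N)ˣ → ↥(gspFinAdelic δ)}
    (hu : ∀ c w, Valued.v ((u c : finAdeleQ) w) = 1)
    (huc : ∀ c, (u c : finAdeleQ) - ((c : ZMod N).val : ℕ) ∈ levelIdeal N)
    (hmult : ∀ c, IsMultiplier (typeFormOver δ finAdeleQ) (rep c : GL (Fin g ⊕ Fin g) finAdeleQ) (u c))
    (hD3 : haveI : IsLocallyNoetherian (specOver ℚ ℂ).left := inferInstanceAs (IsLocallyNoetherian (Spec (CommRingCat.of ℂ)))
      ∀ (c : (ZMod N)ˣ) (Z : Matrix (Fin g) (Fin g) ℂ) (hZ : Z ∈ siegelUpperHalfSpace g)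
        (P' : PolarizedAbelianSchemeWithLevel g N δ (specOver ℚ ℂ).left), IsAdmissibleAt hδ (rep c) Z hZ P' →
          AlgPoints.map (ιc c) (unif c Z) =
            AlgPoints.baseChangeEquiv (algebraMap ℚ ℂ) 𝓜.M (𝓜.classifyingMap (specOver ℚ ℂ) P'))
    (pts : ComplexPoints ((Literature.AlgebraicGeometry.Motives.baseChange ℚ ℂ).obj 𝓜.M) ≃
      SiegelShimuraSet δ (principalLevelSubgroup δ N))
    (hval : ∀ (c : (ZMod N)ˣ) (W : Matrix (Fin g) (Fin g) ℂ) (hW : W ∈ siegelUpperHalfSpace g),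
      pts (AlgPoints.map (ιc c) (unif c W)) =
        SiegelShimuraSet.mk δ (principalLevelSubgroup δ N)
          ⟨jOfSiegel δ W, C0_subset_C0pm δ (jOfSiegel_mem_C0 hδ.1 hW)⟩ (rep c))
    -- the curve datum, the frame, E2's complex structure
    {F : Type} [Field F] [NumberField F] [IsCMField F] (ι₁ : F →+* ℂ) (Jstar : Matrix (Fin 2) (Fin 2) F)
    (hJ : (Jstar.map (IsCMField.complexConj F))ᵀ = Jstar) (Φ : CMType F) (hΦ : ι₁ ∈ Φ.1) {ξ : F}
    (Fr : SymplecticFrameV F (RingHom.id F) Jstar ξ g δ)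
    (hJC : ∀ v : Fin 2 → ℂ, v ∈ negCone (Jstar.map ι₁) → auxComplexStructureV Fr ι₁ Φ v ∈ C0pm δ)
    -- the point map, at any level `K`
    (K : Subgroup ↥(finAdelic (↥(maximalRealSubfield F)) F (IsCMField.complexConj F) 2 Jstar))
    (f : ShimuraSetGS F Jstar ι₁ K → ComplexPoints 𝓜.M)
    (hf : ∀ (v : Fin 2 → ℂ) (hv : v ∈ negCone (Jstar.map ι₁)) (a : ↥(finAdelic (↥(maximalRealSubfield F)) F (IsCMField.complexConj F) 2 Jstar)),
      pts (AlgPoints.baseChangeEquiv (algebraMap ℚ ℂ) 𝓜.M (f (ShimuraSetGS.mk F Jstar ι₁ K v hv a))) =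
        SiegelShimuraSet.mk δ (principalLevelSubgroup δ N) ⟨auxComplexStructureV Fr ι₁ Φ v, hJC v hv⟩ (auxToGspFinV Fr (a, 1))) :
    ∃ E₀ : IntermediateField ℚ ℂ, FiniteDimensional ℚ ↥E₀ ∧ (∀ x : F, ι₁ x ∈ E₀) ∧
      ∀ (Fi : Type) [Field Fi] [NumberField Fi] [Algebra F Fi] (τE : Fi →+* ℂ),
        (∀ x : ℂ, x ∈ E₀ → ∃ y : Fi, τE y = x) →
        letI : Algebra Fi ℂ := τE.toAlgebra
        -- (i) `f_recip` VERBATIM (E-line ED. 4 `AuxChartGS.f_recip`)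
        (∀ (σ : ℂ ≃ₐ[Fi] ℂ) (s : (FiniteAdeleRing (𝓞 F) F)ˣ), IsArtinCorrespondent F ι₁ s σ.toRingEquiv →
          ∀ (w : Fin 2 → F) (hw : (fun i => ι₁ (w i)) ∈ negCone (Jstar.map ι₁))
            (d : ↥(finAdelic (↥(maximalRealSubfield F)) F (IsCMField.complexConj F) 2 Jstar)),
            IsDiagTwistGS F Jstar w (recipFactor F s) d →
            ∀ a : ↥(finAdelic (↥(maximalRealSubfield F)) F (IsCMField.complexConj F) 2 Jstar),
              (σ.restrictScalars ℚ) • f (ShimuraSetGS.mk F Jstar ι₁ K (fun i => ι₁ (w i)) hw a) =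
                f (ShimuraSetGS.mk F Jstar ι₁ K (fun i => ι₁ (w i)) hw (d * a))) ∧
        -- (ii) THE CM DATUM at `J(ι₁ w)` (the input block of ★ `cmConjugationIsogenyAll_holds` + the two class identities)
        (∀ (σ : ℂ ≃ₐ[Fi] ℂ) (s : (FiniteAdeleRing (𝓞 F) F)ˣ), IsArtinCorrespondent F ι₁ s σ.toRingEquiv →
          ∀ (w : Fin 2 → F) (hw : (fun i => ι₁ (w i)) ∈ negCone (Jstar.map ι₁))
            (d : ↥(finAdelic (↥(maximalRealSubfield F)) F (IsCMField.complexConj F) 2 Jstar)),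
            IsDiagTwistGS F Jstar w (recipFactor F s) d →
            ∀ a : ↥(finAdelic (↥(maximalRealSubfield F)) F (IsCMField.complexConj F) 2 Jstar),
              ∃ (E : IntermediateField ℚ ℂ) (_ : NumberField ↥E) (c : CMStructure g δ (Fin 2) (fun _ => F)) (Φ' : Fin 2 → CMType F)
                (sE : (FiniteAdeleRing (𝓞 ↥E) ↥E)ˣ) (r : ↥(gspFinAdelic δ))
                (d' : ↥(finAdelic (↥(maximalRealSubfield F)) F (IsCMField.complexConj F) 2 Jstar)),
                c.IsSpecial ⟨auxComplexStructureV Fr ι₁ Φ (fun i => ι₁ (w i)), hJC _ hw⟩ Φ' ∧ (∀ i, traceField (Φ' i) ≤ E) ∧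
                (∀ x : ℂ, x ∈ E → (σ.restrictScalars ℚ) x = x) ∧
                IsArtinCorrespondent ↥E (algebraMap ↥E ℂ) sE (σ.restrictScalars ℚ).toRingEquiv ∧
                ((r : GL (Fin g ⊕ Fin g) finAdeleQ) : Matrix (Fin g ⊕ Fin g) (Fin g ⊕ Fin g) finAdeleQ) = c.cmRecipMatrix Φ' E sE ∧
                SiegelShimuraSet.mk δ (principalLevelSubgroup δ N) ⟨auxComplexStructureV Fr ι₁ Φ (fun i => ι₁ (w i)), hJC _ hw⟩
                    (r * auxToGspFinV Fr (a, 1)) =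
                  SiegelShimuraSet.mk δ (principalLevelSubgroup δ N) ⟨auxComplexStructureV Fr ι₁ Φ (fun i => ι₁ (w i)), hJC _ hw⟩
                    (auxToGspFinV Fr (d' * a, 1)) ∧
                ∀ K' : Subgroup ↥(finAdelic (↥(maximalRealSubfield F)) F (IsCMField.complexConj F) 2 Jstar),
                  ShimuraSetGS.mk F Jstar ι₁ K' (fun i => ι₁ (w i)) hw (d * a) =
                    ShimuraSetGS.mk F Jstar ι₁ K' (fun i => ι₁ (w i)) hw (d' * a)) := by
  classical
  have hN0 : N ≠ 0 := by omega
  -- E3R-U at `J_Φ` of the curve (special-pair clause discharged)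
  obtain ⟨E₀, hfd, hι₁E₀, hrecip⟩ := exists_sliceField_siegelRecipDatum_curve ι₁ Jstar hJ Φ hΦ hN0 Fr hJC
  refine ⟨E₀, hfd, hι₁E₀, fun Fi _ _ _ τE hcov => ?_⟩
  letI : Algebra Fi ℂ := τE.toAlgebra
  -- `σ|_ℚ` fixes `E₀ ⊆ τE(Fᵢ)` for every `σ ∈ Aut(ℂ∕Fᵢ)`
  have hσ₀ : ∀ (σ : ℂ ≃ₐ[Fi] ℂ) (x : ℂ), x ∈ E₀ → (σ.restrictScalars ℚ) x = x := by
    intro σ x hx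
    obtain ⟨y, rfl⟩ := hcov x hx
    exact σ.commutes y
  -- (ii) the datum, read for `σ.restrictScalars ℚ`
  have hdatum : ∀ (σ : ℂ ≃ₐ[Fi] ℂ) (s : (FiniteAdeleRing (𝓞 F) F)ˣ), IsArtinCorrespondent F ι₁ s σ.toRingEquiv →
      ∀ (w : Fin 2 → F) (hw : (fun i => ι₁ (w i)) ∈ negCone (Jstar.map ι₁))
        (d : ↥(finAdelic (↥(maximalRealSubfield F)) F (IsCMField.complexConj F) 2 Jstar)),
        IsDiagTwistGS F Jstar w (recipFactor F s) d →
        ∀ a : ↥(finAdelic (↥(maximalRealSubfield F)) F (IsCMField.complexConj F) 2 Jstar),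
          ∃ (E : IntermediateField ℚ ℂ) (_ : NumberField ↥E) (c : CMStructure g δ (Fin 2) (fun _ => F)) (Φ' : Fin 2 → CMType F)
            (sE : (FiniteAdeleRing (𝓞 ↥E) ↥E)ˣ) (r : ↥(gspFinAdelic δ))
            (d' : ↥(finAdelic (↥(maximalRealSubfield F)) F (IsCMField.complexConj F) 2 Jstar)),
            c.IsSpecial ⟨auxComplexStructureV Fr ι₁ Φ (fun i => ι₁ (w i)), hJC _ hw⟩ Φ' ∧ (∀ i, traceField (Φ' i) ≤ E) ∧
            (∀ x : ℂ, x ∈ E → (σ.restrictScalars ℚ) x = x) ∧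
            IsArtinCorrespondent ↥E (algebraMap ↥E ℂ) sE (σ.restrictScalars ℚ).toRingEquiv ∧
            ((r : GL (Fin g ⊕ Fin g) finAdeleQ) : Matrix (Fin g ⊕ Fin g) (Fin g ⊕ Fin g) finAdeleQ) = c.cmRecipMatrix Φ' E sE ∧
            SiegelShimuraSet.mk δ (principalLevelSubgroup δ N) ⟨auxComplexStructureV Fr ι₁ Φ (fun i => ι₁ (w i)), hJC _ hw⟩
                (r * auxToGspFinV Fr (a, 1)) =
              SiegelShimuraSet.mk δ (principalLevelSubgroup δ N) ⟨auxComplexStructureV Fr ι₁ Φ (fun i => ι₁ (w i)), hJC _ hw⟩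
                (auxToGspFinV Fr (d' * a, 1)) ∧
            ∀ K' : Subgroup ↥(finAdelic (↥(maximalRealSubfield F)) F (IsCMField.complexConj F) 2 Jstar),
              ShimuraSetGS.mk F Jstar ι₁ K' (fun i => ι₁ (w i)) hw (d * a) =
                ShimuraSetGS.mk F Jstar ι₁ K' (fun i => ι₁ (w i)) hw (d' * a) := by
    intro σ s hs w hw d hd a
    obtain ⟨E, hEnf, c, Φ', sE, r, d', hsp, hE, hEE₀, hsE, hr, hsiegel, hGS⟩ :=
      hrecip (σ.restrictScalars ℚ) (hσ₀ σ) s hs w hw d hd a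
    exact ⟨E, hEnf, c, Φ', sE, r, d', hsp, hE, fun x hx => hσ₀ σ x (hEE₀ hx), hsE, hr, hsiegel, hGS⟩
  refine ⟨fun σ s hs w hw d hd a => ?_, hdatum⟩
  -- (i) `f_recip` = §1 of the datum
  obtain ⟨E, hEnf, c, Φ', sE, r, d', hsp, hE, hσE, hsE, hr, hsiegel, hGS⟩ := hdatum σ s hs w hw d hd a
  haveI : NumberField ↥E := hEnf
  exact smul_f_mk_eq_of_cmDatum hg hδ hN 𝓜 ιc unif hu huc hmult hD3 pts hval ι₁ Jstar (auxComplexStructureV Fr ι₁ Φ) hJC K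
    (fun a' => auxToGspFinV Fr (a', 1)) f hf (σ.restrictScalars ℚ) w hw d a E c Φ' sE r d' hsp hE hσE hsE hr hsiegel (hGS K)

/-! ### §3 (ED. 2) The same constructor, PINNED and EXPLICIT: the datum's CM structure acts by the chart's integral action `ρ₀`, and the twist
identity is the group identity `r·ũ_V(a,1) = ũ_V(d♯a,1)·t`, `t ∈ K_δ(N)` (★ E3R-U ED. 3 `exists_sliceField_siegelRecipDatum_pinned`, LA6-p02 p847886) -/

/-- **`f_recip` AND THE PINNED, EXPLICIT CM RECIPROCITY DATUM OF THE E-LINE CHART, FROM ONE SLICE FIELD** — §2 with two more inputs, E1 7b's integral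
action `ρ : 𝓞 F → M_{2g}(ℤ)` and its frame reading `hρ : (ρ b)_ℚ = P·res(b•1)·Q` (★ `exists_symplecticFrameV_integralAction`, the E-line's `ρ₀`), and (ii)
strengthened to the PINNED EXPLICIT datum: the special structure `c` ACTS BY `ρ` on the diagonal (`(ρ b)_ℚ = c.actMatrix (b, b)` — ★ ED. 3's frame pin
`c.actMatrix (x,x) = P·res(x•1)·Q` composed with `hρ`; necessary downstream because `IsSpecial` alone does not determine `c.act`, LA6-p02's finding), and the
Siegel clause is the GROUP identity `∃ t ∈ K_δ(N), r·ũ_V(a,1) = ũ_V(d♯·a,1)·t` (its class form is one line by ★ `SiegelShimuraSet.mk_mul_of_mem`).  (i) `f_recip`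
is again §1 of (ii).  This is the at-birth constructor of the E-line ED. 5 field `AuxChartGS.cm_recip` in the form the Σ-GAL kernel instance consumes
(★ `F0P6aCMHomKernelShape.exists_cmConjHom_kernelShape`: operand `rcm * ah = b₂ * t`; (K-c) `hlin` via ★ `SiegelCMRecipCommutesAction` + the pin + `Mρ_frame`).
[cite: Milne2005ShimuraVarieties, Def. 12.8 (62) p. 114 and Prop. 14.12 p. 125] [cite: Deligne1971TravauxShimura, 4.18 p. 150, 5.11 p. 158 and Thm. 4.21 p. 152]
[cite: RapoportSmithlingZhang2020Diagonal, Remark 3.1 p. 9 and (3.10)] -/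
theorem exists_sliceField_f_recip_cmDatum_pinned {g N : ℕ} {δ : Fin g → ℕ} (hg : 0 < g) (hδ : IsPolarizationType δ) (hN : 3 ≤ N)
    (𝓜 : SiegelFineModuliScheme g N δ)
    {Sc : (ZMod N)ˣ → SchemeOver ℂ} (ιc : ∀ c, Sc c ⟶ (Literature.AlgebraicGeometry.Motives.baseChange ℚ ℂ).obj 𝓜.M)
    (unif : ∀ _c : (ZMod N)ˣ, Matrix (Fin g) (Fin g) ℂ → ComplexPoints (Sc _c))
    {u : (ZMod N)ˣ → finAdeleQˣ} {rep : (ZMod N)ˣ → ↥(gspFinAdelic δ)}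
    (hu : ∀ c w, Valued.v ((u c : finAdeleQ) w) = 1)
    (huc : ∀ c, (u c : finAdeleQ) - ((c : ZMod N).val : ℕ) ∈ levelIdeal N)
    (hmult : ∀ c, IsMultiplier (typeFormOver δ finAdeleQ) (rep c : GL (Fin g ⊕ Fin g) finAdeleQ) (u c))
    (hD3 : haveI : IsLocallyNoetherian (specOver ℚ ℂ).left := inferInstanceAs (IsLocallyNoetherian (Spec (CommRingCat.of ℂ)))
      ∀ (c : (ZMod N)ˣ) (Z : Matrix (Fin g) (Fin g) ℂ) (hZ : Z ∈ siegelUpperHalfSpace g)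
        (P' : PolarizedAbelianSchemeWithLevel g N δ (specOver ℚ ℂ).left), IsAdmissibleAt hδ (rep c) Z hZ P' →
          AlgPoints.map (ιc c) (unif c Z) =
            AlgPoints.baseChangeEquiv (algebraMap ℚ ℂ) 𝓜.M (𝓜.classifyingMap (specOver ℚ ℂ) P'))
    (pts : ComplexPoints ((Literature.AlgebraicGeometry.Motives.baseChange ℚ ℂ).obj 𝓜.M) ≃
      SiegelShimuraSet δ (principalLevelSubgroup δ N))
    (hval : ∀ (c : (ZMod N)ˣ) (W : Matrix (Fin g) (Fin g) ℂ) (hW : W ∈ siegelUpperHalfSpace g),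
      pts (AlgPoints.map (ιc c) (unif c W)) =
        SiegelShimuraSet.mk δ (principalLevelSubgroup δ N)
          ⟨jOfSiegel δ W, C0_subset_C0pm δ (jOfSiegel_mem_C0 hδ.1 hW)⟩ (rep c))
    -- the curve datum, the frame, E2's complex structure, E1's integral action read in the frame
    {F : Type} [Field F] [NumberField F] [IsCMField F] (ι₁ : F →+* ℂ) (Jstar : Matrix (Fin 2) (Fin 2) F)
    (hJ : (Jstar.map (IsCMField.complexConj F))ᵀ = Jstar) (Φ : CMType F) (hΦ : ι₁ ∈ Φ.1) {ξ : F}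
    (Fr : SymplecticFrameV F (RingHom.id F) Jstar ξ g δ)
    (hJC : ∀ v : Fin 2 → ℂ, v ∈ negCone (Jstar.map ι₁) → auxComplexStructureV Fr ι₁ Φ v ∈ C0pm δ)
    (ρ : 𝓞 F →+* Matrix (Fin g ⊕ Fin g) (Fin g ⊕ Fin g) ℤ)
    (hρ : ∀ b : 𝓞 F, (ρ b).map (Int.cast : ℤ → ℚ) =
      framePV Fr * resMatrix (m := Fin 2) (Literature.AlgebraicGeometry.ShimuraVarieties.UnitaryCanonicalModel.Aux.ratBasis F)
        (((b : 𝓞 F) : F) • (1 : Matrix (Fin 2) (Fin 2) F)) * frameQV Fr)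
    -- the point map, at any level `K`
    (K : Subgroup ↥(finAdelic (↥(maximalRealSubfield F)) F (IsCMField.complexConj F) 2 Jstar))
    (f : ShimuraSetGS F Jstar ι₁ K → ComplexPoints 𝓜.M)
    (hf : ∀ (v : Fin 2 → ℂ) (hv : v ∈ negCone (Jstar.map ι₁)) (a : ↥(finAdelic (↥(maximalRealSubfield F)) F (IsCMField.complexConj F) 2 Jstar)),
      pts (AlgPoints.baseChangeEquiv (algebraMap ℚ ℂ) 𝓜.M (f (ShimuraSetGS.mk F Jstar ι₁ K v hv a))) =
        SiegelShimuraSet.mk δ (principalLevelSubgroup δ N) ⟨auxComplexStructureV Fr ι₁ Φ v, hJC v hv⟩ (auxToGspFinV Fr (a, 1))) :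
    ∃ E₀ : IntermediateField ℚ ℂ, FiniteDimensional ℚ ↥E₀ ∧ (∀ x : F, ι₁ x ∈ E₀) ∧
      ∀ (Fi : Type) [Field Fi] [NumberField Fi] [Algebra F Fi] (τE : Fi →+* ℂ),
        (∀ x : ℂ, x ∈ E₀ → ∃ y : Fi, τE y = x) →
        letI : Algebra Fi ℂ := τE.toAlgebra
        -- (i) `f_recip` VERBATIM (E-line `AuxChartGS.f_recip`)
        (∀ (σ : ℂ ≃ₐ[Fi] ℂ) (s : (FiniteAdeleRing (𝓞 F) F)ˣ), IsArtinCorrespondent F ι₁ s σ.toRingEquiv →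
          ∀ (w : Fin 2 → F) (hw : (fun i => ι₁ (w i)) ∈ negCone (Jstar.map ι₁))
            (d : ↥(finAdelic (↥(maximalRealSubfield F)) F (IsCMField.complexConj F) 2 Jstar)),
            IsDiagTwistGS F Jstar w (recipFactor F s) d →
            ∀ a : ↥(finAdelic (↥(maximalRealSubfield F)) F (IsCMField.complexConj F) 2 Jstar),
              (σ.restrictScalars ℚ) • f (ShimuraSetGS.mk F Jstar ι₁ K (fun i => ι₁ (w i)) hw a) =
                f (ShimuraSetGS.mk F Jstar ι₁ K (fun i => ι₁ (w i)) hw (d * a))) ∧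
        -- (ii) THE PINNED EXPLICIT CM DATUM at `J(ι₁ w)`
        (∀ (σ : ℂ ≃ₐ[Fi] ℂ) (s : (FiniteAdeleRing (𝓞 F) F)ˣ), IsArtinCorrespondent F ι₁ s σ.toRingEquiv →
          ∀ (w : Fin 2 → F) (hw : (fun i => ι₁ (w i)) ∈ negCone (Jstar.map ι₁))
            (d : ↥(finAdelic (↥(maximalRealSubfield F)) F (IsCMField.complexConj F) 2 Jstar)),
            IsDiagTwistGS F Jstar w (recipFactor F s) d →
            ∀ a : ↥(finAdelic (↥(maximalRealSubfield F)) F (IsCMField.complexConj F) 2 Jstar),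
              ∃ (E : IntermediateField ℚ ℂ) (_ : NumberField ↥E) (c : CMStructure g δ (Fin 2) (fun _ => F)) (Φ' : Fin 2 → CMType F)
                (sE : (FiniteAdeleRing (𝓞 ↥E) ↥E)ˣ) (r : ↥(gspFinAdelic δ))
                (d' : ↥(finAdelic (↥(maximalRealSubfield F)) F (IsCMField.complexConj F) 2 Jstar)),
                c.IsSpecial ⟨auxComplexStructureV Fr ι₁ Φ (fun i => ι₁ (w i)), hJC _ hw⟩ Φ' ∧
                (∀ b : 𝓞 F, (ρ b).map (Int.cast : ℤ → ℚ) = c.actMatrix (fun _ => ((b : 𝓞 F) : F))) ∧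
                (∀ i, traceField (Φ' i) ≤ E) ∧
                (∀ x : ℂ, x ∈ E → (σ.restrictScalars ℚ) x = x) ∧
                IsArtinCorrespondent ↥E (algebraMap ↥E ℂ) sE (σ.restrictScalars ℚ).toRingEquiv ∧
                ((r : GL (Fin g ⊕ Fin g) finAdeleQ) : Matrix (Fin g ⊕ Fin g) (Fin g ⊕ Fin g) finAdeleQ) = c.cmRecipMatrix Φ' E sE ∧
                (∃ t ∈ principalLevelSubgroup δ N, r * auxToGspFinV Fr (a, 1) = auxToGspFinV Fr (d' * a, 1) * t) ∧
                ∀ K' : Subgroup ↥(finAdelic (↥(maximalRealSubfield F)) F (IsCMField.complexConj F) 2 Jstar),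
                  ShimuraSetGS.mk F Jstar ι₁ K' (fun i => ι₁ (w i)) hw (d * a) =
                    ShimuraSetGS.mk F Jstar ι₁ K' (fun i => ι₁ (w i)) hw (d' * a)) := by
  classical
  have hN0 : N ≠ 0 := by omega
  -- E3R-U ED. 3 at `J_Φ` of the curve (special-pair clause discharged), pinned explicit form
  obtain ⟨E₀, hfd, hι₁E₀, hrecip⟩ := exists_sliceField_siegelRecipDatum_pinned ι₁ Jstar hJ Φ hΦ hN0 Fr (auxComplexStructureV Fr ι₁ Φ) hJC
    (fun w hw b hb1 hperp c hc Φ' h0 h1 => isSpecial_auxComplexStructureV_curve ι₁ Jstar hJ Φ Fr hJC w hw b hb1 hperp c hc Φ' h0 h1)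
  refine ⟨E₀, hfd, hι₁E₀, fun Fi _ _ _ τE hcov => ?_⟩
  letI : Algebra Fi ℂ := τE.toAlgebra
  -- `σ|_ℚ` fixes `E₀ ⊆ τE(Fᵢ)` for every `σ ∈ Aut(ℂ∕Fᵢ)`
  have hσ₀ : ∀ (σ : ℂ ≃ₐ[Fi] ℂ) (x : ℂ), x ∈ E₀ → (σ.restrictScalars ℚ) x = x := by
    intro σ x hx
    obtain ⟨y, rfl⟩ := hcov x hx
    exact σ.commutes y
  -- (ii) the datum, read for `σ.restrictScalars ℚ`, with the pin composed with `hρ`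
  have hdatum : ∀ (σ : ℂ ≃ₐ[Fi] ℂ) (s : (FiniteAdeleRing (𝓞 F) F)ˣ), IsArtinCorrespondent F ι₁ s σ.toRingEquiv →
      ∀ (w : Fin 2 → F) (hw : (fun i => ι₁ (w i)) ∈ negCone (Jstar.map ι₁))
        (d : ↥(finAdelic (↥(maximalRealSubfield F)) F (IsCMField.complexConj F) 2 Jstar)),
        IsDiagTwistGS F Jstar w (recipFactor F s) d →
        ∀ a : ↥(finAdelic (↥(maximalRealSubfield F)) F (IsCMField.complexConj F) 2 Jstar),
          ∃ (E : IntermediateField ℚ ℂ) (_ : NumberField ↥E) (c : CMStructure g δ (Fin 2) (fun _ => F)) (Φ' : Fin 2 → CMType F)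
            (sE : (FiniteAdeleRing (𝓞 ↥E) ↥E)ˣ) (r : ↥(gspFinAdelic δ))
            (d' : ↥(finAdelic (↥(maximalRealSubfield F)) F (IsCMField.complexConj F) 2 Jstar)),
            c.IsSpecial ⟨auxComplexStructureV Fr ι₁ Φ (fun i => ι₁ (w i)), hJC _ hw⟩ Φ' ∧
            (∀ b : 𝓞 F, (ρ b).map (Int.cast : ℤ → ℚ) = c.actMatrix (fun _ => ((b : 𝓞 F) : F))) ∧
            (∀ i, traceField (Φ' i) ≤ E) ∧
            (∀ x : ℂ, x ∈ E → (σ.restrictScalars ℚ) x = x) ∧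
            IsArtinCorrespondent ↥E (algebraMap ↥E ℂ) sE (σ.restrictScalars ℚ).toRingEquiv ∧
            ((r : GL (Fin g ⊕ Fin g) finAdeleQ) : Matrix (Fin g ⊕ Fin g) (Fin g ⊕ Fin g) finAdeleQ) = c.cmRecipMatrix Φ' E sE ∧
            (∃ t ∈ principalLevelSubgroup δ N, r * auxToGspFinV Fr (a, 1) = auxToGspFinV Fr (d' * a, 1) * t) ∧
            ∀ K' : Subgroup ↥(finAdelic (↥(maximalRealSubfield F)) F (IsCMField.complexConj F) 2 Jstar),
              ShimuraSetGS.mk F Jstar ι₁ K' (fun i => ι₁ (w i)) hw (d * a) =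
                ShimuraSetGS.mk F Jstar ι₁ K' (fun i => ι₁ (w i)) hw (d' * a) := by
    intro σ s hs w hw d hd a
    obtain ⟨E, hEnf, c, Φ', sE, r, d', hsp, hpin, hE, hEE₀, hsE, hr, ht, hGS⟩ :=
      hrecip (σ.restrictScalars ℚ) (hσ₀ σ) s hs w hw d hd a
    exact ⟨E, hEnf, c, Φ', sE, r, d', hsp, fun b => (hρ b).trans (hpin _).symm, hE, fun x hx => hσ₀ σ x (hEE₀ hx), hsE, hr, ht, hGS⟩
  refine ⟨fun σ s hs w hw d hd a => ?_, hdatum⟩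
  -- (i) `f_recip` = §1 of the datum (class identity from the explicit one by ★ `SiegelShimuraSet.mk_mul_of_mem`)
  obtain ⟨E, hEnf, c, Φ', sE, r, d', hsp, -, hE, hσE, hsE, hr, ⟨t, ht, hsplit⟩, hGS⟩ := hdatum σ s hs w hw d hd a
  haveI : NumberField ↥E := hEnf
  have hsiegel : SiegelShimuraSet.mk δ (principalLevelSubgroup δ N) ⟨auxComplexStructureV Fr ι₁ Φ (fun i => ι₁ (w i)), hJC _ hw⟩
        (r * auxToGspFinV Fr (a, 1)) =
      SiegelShimuraSet.mk δ (principalLevelSubgroup δ N) ⟨auxComplexStructureV Fr ι₁ Φ (fun i => ι₁ (w i)), hJC _ hw⟩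
        (auxToGspFinV Fr (d' * a, 1)) := by
    rw [hsplit]; exact SiegelShimuraSet.mk_mul_of_mem δ (principalLevelSubgroup δ N) _ _ ht
  exact smul_f_mk_eq_of_cmDatum hg hδ hN 𝓜 ιc unif hu huc hmult hD3 pts hval ι₁ Jstar (auxComplexStructureV Fr ι₁ Φ) hJC K
    (fun a' => auxToGspFinV Fr (a', 1)) f hf (σ.restrictScalars ℚ) w hw d a E c Φ' sE r d' hsp hE hσE hsE hr hsiegel (hGS K)

end Summit.HodgeConjecture.HodgeConjecture.Theorems.F0P6aSpecialPairRecipDatumOfChart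

end
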